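import Summits.QuantumFields.BalabanUV.Beta.FP.TorusNestedReadoutReference
import Summits.QuantumFields.BalabanUV.Beta.FP.QstepSymTwoBlock
import Summits.QuantumFields.BalabanUV.Beta.FP.RelInvPeriodisedComb

/-!
# `BalabanUV.Beta.FP.QstepSymBlockTranslate` — road «FP», binder row D1, ROUTE T (β1), STUB P of the row's ONE file, (C) part 5 of 5 (J-NOTE-20 §8, R-AN2-76-PB's VALUE half):
# **THE BLOCK-TRANSLATION LETTER (TQ) DISCHARGED AT THE RECORD's `QSym Lc`, AND THE CROSS-TORUS IDENTITY OF THE TREE-GAUGE READ-OUT UNCONDITIONAL AT THE WRAPPER's `compRowsSym`**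

SETTING (parts 1–5 of (C)).  Two towers over top tori `M`, `M′` (`Lc ∣ M i`, `Lc ∣ M′ i`), same `Lc`, `lev`, `rs`, depth `n+1`; a block shift `v : Site (d+1)`: top sites move by
`Lc • v`, the finest sites by `bigRatio Lc (n+1) • v = Lc^(n+2) • v`; slots correspond («Corr») when the sites of `towerEquiv⁻¹` differ by that shift, finest bonds when their base
points do (same direction).  Objects as in parts (A1)(A2): `N := fromRows (τ₂·Q₁₀) τ₁` (letter `hN`), `Q₁₀ = compRowsG Lc Q M lev rs (n+1)` for a GENERIC `Q : StepRows d Lc`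
under the displayed letters (TB) (two-block support of non-wrapping rows) and (TQ) (block-translation covariance of non-wrapping rows:
`↑a′ = ↑a + Lc•v → ↑b′ = ↑b + Lc•(Lc•v) → ↑a + e_ν ∈ pbox M → ↑a′ + e_ν ∈ pbox M′ → Q M ℓ r (a,ν) (b,κ) = Q M′ ℓ r (a′,ν) (b′,κ)`), both discharged at the record's `QSym Lc`
(`FP/QstepSymTwoBlock`, `FP/QstepSymBlockTranslate`); `τ₁ = bigP` of the lower tower, `τ₂ = combF`, `W₀ = towerGen`, `E = towerEvalC`.

WHAT, this part ([folklore]; no `def`, no `def … : Prop`, nothing cited, 0 sorry, default heartbeats): §1 `eq_zero_of_translate_eq_self`, **`QSym_apply_eq_of_nonwrap`** (on a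
NON-WRAPPING row the periodised one-step entry IS the lattice entry of an1's shifted straight spread at the coarse point: `QSym Lc M ℓ r (a,ν) (b,κ) = bhKStepSh d Lc (Dsh Lc) ℓ
(Lc•a) b (inr ν) (inl κ)` — every other copy of the periodisation sum vanishes by (B)'s `bhKStepSh_Dsh_inr_inl_symLinAvgAt ∕ symLinAvgAt_delta1_ne_zero ∕ translate_eq_self_of_quo_mem`:
its block would be a box point; `tsum_eq_single`), **`QSym_blockTranslate`** = (TQ) at `QSym Lc` (§1 on both towers + leaf-06's `RelInvPeriodisedComb.shiftK_bhKStepSh`: the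
spread is invariant under simultaneous `Lcℤ^(d+1)` shifts); §2 **`treeGauge_readout_corr_sym`**, **`readout_mulVec_corr_sym`** — part 4's identities with
`hQ₁₀ : Q₁₀ = compRowsSym Lc M lev rs (n+1)`, `hQ₁₀′ : Q₁₀′ = compRowsSym Lc M′ lev rs (n+1)` (g53 (D) §2's ∕ leaf-06 G-2's letter on each box VERBATIM) and (TB)(TQ) DISCHARGED
(`QSym_twoBlock`, `QSym_blockTranslate`): STUB P (P-b) IN VALUE FORM, UNCONDITIONAL AT THE RECORD — «the END wrapper's tree-gauge read-out `lv v s` on the box `B` equals the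
read-out of ANY box `B′` at the corresponding site fed with the correspondingly translated chart column, provided the two columns agree on the bonds inside `s`'s big block»;
the reference torus `M′ = fun _ => Lc` is the instance (P-c) consumes.
WHAT THIS IS NOT: not (P-c) itself (the lattice `λℤ` as a `def`, its `Mc B`-periodisation = `lv` — the row's, on top of this identity); `hlve` NOT instantiated; no row of
v9∕v10 discharged; nothing of Bałaban's asserted, valued or discharged; 0 estimates; 0∕4 row-D1 binders (hW, hR, D1Tel, D1Rep); ROOT M‴ p325680 untouched; NOT (C1), NOT (L2′),
NOT (T-ID), NOT SDF, NOT D1, NEVER «G-an2-4 closed», NOT BetaPertH, NOT continuum, NOT Clay.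

HONEST DEPENDENCY (page 1, mandatory): continuum YM on T⁴ ⇐ BetaPertH ∧ nine spine estimates (0/9 proved); BetaPertH ⇐ (D1) ∧ (D4) ∧ CAP+tail;
G-an2-4 gates asym, D1 and NE2/3/4.  HONEST FRAMING (cell contract, verbatim): «discharging `BetaPertH` makes Bałaban's UV stability UNCONDITIONAL —
a real constructive-QFT result; it is NOT the continuum limit and NOT the Clay problem.»  ABSOLUTE RULE (cell charter, verbatim): «No internally-minted
statement may enter as a cited fact. Every hypothesis is either kernel-proved in this package or a verbatim quotation of a PUBLISHED theorem with page
reference. The manuscript(s) under audit are NOT citable for their own disputed steps — they are the thing under adjudication; programme-internal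
(2001/route/tribunal) claims are never citable.»  Road «FP» OWNER, b2b-balaban-beta-d1-p3 gen 54, 2026-08-29.  No existing file touched.
-/

noncomputable section

namespace Summit.QuantumFields.BalabanUV.Beta.FP.QstepSymBlockTranslate

open Matrix Finset
open scoped BigOperators
open Literature.Probability.LatticeModels (Torus.proj)
open Literature.MathematicalPhysics.QuantumFieldTheory
open Literature.MathematicalPhysics.QuantumFieldTheory.Balaban1983to89
open Literature.MathematicalPhysics.QuantumFieldTheory.Balaban1983to89.Beta
open ExpKernelCalculus (shiftK)
open B5Prop11Plancherel (fine)
open B6Lemma24Torus (pbox mem_pbox)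
open AffineAveraging (Site box toSite unitVec)
open AveragingContoursRooted (ctr ctrOff ctrOff_mem_box)
open KKTFluctuationKernel (delta1)
open OneStepResolventKernel (Fib quo_zsmul)
open Literature.MathematicalPhysics.QuantumFieldTheory.LatticeForm (quo)
open B4TorusKernel.MultiPeriod (translate)
open Summit.QuantumFields.BalabanUV.Beta.SymShiftedSpread (bhKStepSh)
open Summit.QuantumFields.BalabanUV.Beta.DshAn1 (Dsh)
open Summit.QuantumFields.BalabanUV.Beta.SymmetrisedAxialPotential (symLinAvgAt)
open Summit.QuantumFields.BalabanUV.Beta.FP.KernelPeriodisationFib (Idx perF perF_apply perZ_apply translate_eq_add)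
open Summit.QuantumFields.BalabanUV.Beta.FP.TorusGaugeCovarianceCoarse (coarsePt coarsePt_coe)
open Summit.QuantumFields.BalabanUV.Beta.FP.RelInvPeriodisedComb (shiftK_bhKStepSh)
open Summit.QuantumFields.BalabanUV.Beta.FP.TorusCombRows (Res)
open Summit.QuantumFields.BalabanUV.Beta.FP.TorusCombNestedBasis (quo_mem_pbox)
open Summit.QuantumFields.BalabanUV.Beta.FP.TorusCompositeObjects
open Summit.QuantumFields.BalabanUV.Beta.FP.TorusCompositeObjectsG (StepRows compRowsG QstepSym QSym compRowsSym)
open Summit.QuantumFields.BalabanUV.Beta.FP.TorusCompositeUnimodular (towerEvalC)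
open Summit.QuantumFields.BalabanUV.Beta.FP.TorusNestedReadoutRows
open Summit.QuantumFields.BalabanUV.Beta.FP.QstepSymTwoBlock
open Summit.QuantumFields.BalabanUV.Beta.FP.TorusCombTranslate
open Summit.QuantumFields.BalabanUV.Beta.FP.TorusNestedReadoutReference

variable {d : ℕ}

/-! ## §1 Only the copy `m = 0` of the periodisation sum survives on a non-wrapping row -/

section Copies

variable (Lc : ℕ) [NeZero Lc]

/-- [folklore] a copy `translate (fine N M) b m` of a fine-box point that is again that point has copy index `0` (`M i ≥ 1`). -/
theorem eq_zero_of_translate_eq_self {N : ℕ} (hN : 0 < N) {M : Fin (d + 1) → ℕ} [∀ μ, NeZero (M μ)] (b m : Site (d + 1))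
    (h : translate (fine N M) b m = b) : m = 0 := by
  funext i
  have hi := congrFun h i
  rw [translate_eq_add] at hi
  simp only [Pi.add_apply, fine, Nat.cast_mul, add_eq_left] at hi
  rcases mul_eq_zero.1 hi with h0 | h0
  · exfalso
    rcases mul_eq_zero.1 h0 with h1 | h1
    · exact (Nat.pos_iff_ne_zero.1 hN) (by exact_mod_cast h1)
    · exact (NeZero.ne (M i)) (by exact_mod_cast h1)
  · exact h0

/-- [folklore] **ON A NON-WRAPPING ROW THE PERIODISED ENTRY IS THE LATTICE ENTRY**: `QSym Lc M ℓ r (a,ν) (b,κ) = bhKStepSh d Lc (Dsh Lc) ℓ (Lc•a) b (inr ν) (inl κ)` when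
`↑a + e_ν ∈ pbox M` (every other copy of the periodisation sum vanishes: §2 of `QstepSymTwoBlock` puts its block at a box point, so it IS `b`). -/
theorem QSym_apply_eq_of_nonwrap (M : Fin (d + 1) → ℕ) [∀ μ, NeZero (M μ)] (ℓ : ℕ) (r : Fin (d + 1) → ℕ) (a : ↥(pbox M)) (ν : Fin (d + 1))
    (b : ↥(pbox (fine Lc M))) (κ : Fin (d + 1)) (ha : (a : Site (d + 1)) + unitVec ν ∈ pbox M) :
    QSym Lc M ℓ r (a, ν) (b, κ) = bhKStepSh d Lc (Dsh Lc) ℓ ((Lc : ℤ) • (a : Site (d + 1))) (b : Site (d + 1)) (Sum.inr ν) (Sum.inl κ) := by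
  have hLc : 0 < Lc := Nat.pos_of_ne_zero (NeZero.ne Lc)
  have hL1 : 1 ≤ Lc := hLc
  have e : QSym Lc M ℓ r (a, ν) (b, κ) = perF (fine Lc M) (bhKStepSh d Lc (Dsh Lc) ℓ) (coarsePt M Lc a, Sum.inr ν) (b, Sum.inl κ) := rfl
  rw [e, perF_apply, perZ_apply, coarsePt_coe]
  rw [tsum_eq_single (0 : Fin (d + 1) → ℤ)]
  · congr 1
    rw [translate_eq_add]; funext i; simp
  · intro m hm
    by_contra hne
    apply hm
    -- a nonzero copy has its block at a box point, so it is `b` itself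
    have hmv := hne
    rw [bhKStepSh_Dsh_inr_inl_symLinAvgAt, if_pos (OneStepResolventKernel.proj_zsmul (a : Site (d + 1))), quo_zsmul] at hmv
    have hsym : symLinAvgAt (ctr (d + 1) Lc) (delta1 κ (translate (fine Lc M) (b : Site (d + 1)) m)) Lc ν (a : Site (d + 1)) ≠ 0 := by
      intro h0; apply hmv; rw [h0, mul_zero, mul_zero]
    have two := symLinAvgAt_delta1_ne_zero hL1 (ctrOff_mem_box (d := d + 1) hL1) κ _ ν (a : Site (d + 1)) hsym
    have hq : quo Lc (translate (fine Lc M) (b : Site (d + 1)) m) ∈ pbox M := by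
      rcases two.1 with e1 | e1 <;> rw [e1]
      · exact a.2
      · exact ha
    exact eq_zero_of_translate_eq_self hLc _ m (translate_eq_self_of_quo_mem hLc b.2 m hq)

/-- [folklore] **(TQ) — THE RECORD's ONE-STEP ROWS ARE BLOCK-TRANSLATION COVARIANT ON NON-WRAPPING ROWS**: `QSym Lc M ℓ r (a,ν) (b,κ) = QSym Lc M′ ℓ r (a′,ν) (b′,κ)` for
`a′ = a + Lc•v`, `b′ = b + Lc•(Lc•v)` (§1 on both sides, then leaf-06's `shiftK_bhKStepSh`: an1's shifted straight spread is invariant under simultaneous `Lcℤ^{d+1}` shifts). -/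
theorem QSym_blockTranslate (M M' : Fin (d + 1) → ℕ) [∀ μ, NeZero (M μ)] [∀ μ, NeZero (M' μ)] (ℓ : ℕ) (r : Fin (d + 1) → ℕ) (v : Site (d + 1))
    (a : ↥(pbox M)) (a' : ↥(pbox M')) (ν : Fin (d + 1)) (b : ↥(pbox (fine Lc M))) (b' : ↥(pbox (fine Lc M'))) (κ : Fin (d + 1))
    (ha' : (a' : Site (d + 1)) = (a : Site (d + 1)) + (Lc : ℤ) • v) (hb' : (b' : Site (d + 1)) = (b : Site (d + 1)) + (Lc : ℤ) • ((Lc : ℤ) • v))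
    (ha : (a : Site (d + 1)) + unitVec ν ∈ pbox M) (hat' : (a' : Site (d + 1)) + unitVec ν ∈ pbox M') :
    QSym Lc M ℓ r (a, ν) (b, κ) = QSym Lc M' ℓ r (a', ν) (b', κ) := by
  rw [QSym_apply_eq_of_nonwrap Lc M ℓ r a ν b κ ha, QSym_apply_eq_of_nonwrap Lc M' ℓ r a' ν b' κ hat', ha', hb', smul_add]
  have h := shiftK_bhKStepSh (d := d) (Lc := Lc) ((Lc : ℤ) • v) ℓ
  have h' := congrFun (congrFun (congrFun (congrFun h ((Lc : ℤ) • (a : Site (d + 1)))) (b : Site (d + 1))) (Sum.inr ν)) (Sum.inl κ)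
  rw [← h']
  rfl

end Copies

/-! ## §2 The cross-torus identity of the read-out AT THE RECORD (`compRowsSym`), (TB) and (TQ) discharged -/

section Record

variable (Lc : ℕ) [NeZero Lc] (M M' : Fin (d + 1) → ℕ) [∀ μ, NeZero (M μ)] [∀ μ, NeZero (M' μ)] (lev : ℕ → ℕ) (rs : ℕ → (Fin (d + 1) → ℕ))
  (hrs : ∀ k i, 0 ≤ toSite (rs k) i ∧ toSite (rs k) i < (Lc : ℤ)) (hM : ∀ i, Lc ∣ M i) (hM' : ∀ i, Lc ∣ M' i) (n : ℕ) (v : Site (d + 1))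
include hM hM'

/-- **STUB P (P-b) VALUE FORM AT THE RECORD — THE TREE-GAUGE READ-OUTS OF TWO BOXES AGREE AT CORRESPONDING FINEST SITES**: `FP/TorusNestedReadoutReference.treeGauge_readout_corr`
with `Q₁₀ = compRowsSym Lc M lev rs (n+1)`, `Q₁₀′ = compRowsSym Lc M′ lev rs (n+1)` (g53 (D) §2's ∕ leaf-06 G-2's letter on each box) and (TB)(TQ) DISCHARGED (`QSym_twoBlock`,
`QSym_blockTranslate`).  With `M′ := fun _ => Lc` (one big block, `v := −(block of s)`) this is J-NOTE-20 §8's «general-box read-out = reference read-out on each block». -/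
theorem treeGauge_readout_corr_sym
    {Q₁₀ : Matrix (↥(pbox M) × Fin (d + 1)) (↥(pbox (towerTorus Lc M (n + 1))) × Fin (d + 1)) ℝ} (hQ₁₀ : Q₁₀ = compRowsSym Lc M lev rs (n + 1))
    {τ₁ : Matrix (NParam Lc (fine Lc M) (fun k => rs (k + 1)) n) (↥(pbox (towerTorus Lc M (n + 1))) × Fin (d + 1)) ℝ}
    (hτ₁ : τ₁ = bigP Lc (fine Lc M) (fun k => rs (k + 1)) (fun k => hrs (k + 1)) n)
    {τ₂ : Matrix (Res (toSite (rs 0)) Lc M) (↥(pbox M) × Fin (d + 1)) ℝ} (hτ₂ : τ₂ = combF Lc M (rs 0))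
    {N : Matrix (NParam Lc M rs (n + 1)) (↥(pbox (towerTorus Lc M (n + 1))) × Fin (d + 1)) ℝ} (hN : N = Matrix.fromRows (τ₂ * Q₁₀) τ₁)
    {W₀ : Matrix (↥(pbox (towerTorus Lc M (n + 1))) × Fin (d + 1)) (NParam Lc M rs (n + 1)) ℝ} (hW₀ : W₀ = towerGen Lc M rs (n + 1))
    {E : Matrix (NParam Lc M rs (n + 1)) (NParam Lc M rs (n + 1)) ℝ} (hE : E = towerEvalC Lc M rs hrs (n + 1))
    {Q₁₀' : Matrix (↥(pbox M') × Fin (d + 1)) (↥(pbox (towerTorus Lc M' (n + 1))) × Fin (d + 1)) ℝ} (hQ₁₀' : Q₁₀' = compRowsSym Lc M' lev rs (n + 1))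
    {τ₁' : Matrix (NParam Lc (fine Lc M') (fun k => rs (k + 1)) n) (↥(pbox (towerTorus Lc M' (n + 1))) × Fin (d + 1)) ℝ}
    (hτ₁' : τ₁' = bigP Lc (fine Lc M') (fun k => rs (k + 1)) (fun k => hrs (k + 1)) n)
    {τ₂' : Matrix (Res (toSite (rs 0)) Lc M') (↥(pbox M') × Fin (d + 1)) ℝ} (hτ₂' : τ₂' = combF Lc M' (rs 0))
    {N' : Matrix (NParam Lc M' rs (n + 1)) (↥(pbox (towerTorus Lc M' (n + 1))) × Fin (d + 1)) ℝ} (hN' : N' = Matrix.fromRows (τ₂' * Q₁₀') τ₁')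
    {W₀' : Matrix (↥(pbox (towerTorus Lc M' (n + 1))) × Fin (d + 1)) (NParam Lc M' rs (n + 1)) ℝ} (hW₀' : W₀' = towerGen Lc M' rs (n + 1))
    {E' : Matrix (NParam Lc M' rs (n + 1)) (NParam Lc M' rs (n + 1)) ℝ} (hE' : E' = towerEvalC Lc M' rs hrs (n + 1))
    (hTW : (N * W₀).det ≠ 0) (hTW' : (N' * W₀').det ≠ 0)
    {θ : NParam Lc M rs (n + 1) → ℝ} {θ' : NParam Lc M' rs (n + 1) → ℝ}
    {X : ↥(pbox (towerTorus Lc M (n + 1))) × Fin (d + 1) → ℝ} {X' : ↥(pbox (towerTorus Lc M' (n + 1))) × Fin (d + 1) → ℝ}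
    (hθ : (N * W₀) *ᵥ θ = -(N *ᵥ X)) (hθ' : (N' * W₀') *ᵥ θ' = -(N' *ᵥ X'))
    (s : ↥(pbox (towerTorus Lc M (n + 1)))) (s' : ↥(pbox (towerTorus Lc M' (n + 1))))
    (hs : (s' : Site (d + 1)) = (s : Site (d + 1)) + ((bigRatio Lc (n + 1) : ℕ) : ℤ) • v)
    (hX : ∀ (b : ↥(pbox (towerTorus Lc M (n + 1))) × Fin (d + 1)) (b' : ↥(pbox (towerTorus Lc M' (n + 1))) × Fin (d + 1)),
      (b'.1 : Site (d + 1)) = (b.1 : Site (d + 1)) + ((bigRatio Lc (n + 1) : ℕ) : ℤ) • v → b'.2 = b.2 →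
      quo (bigRatio Lc (n + 1)) (b.1 : Site (d + 1)) = quo (bigRatio Lc (n + 1)) (s : Site (d + 1)) →
      quo (bigRatio Lc (n + 1)) ((b.1 : Site (d + 1)) + unitVec b.2) = quo (bigRatio Lc (n + 1)) (s : Site (d + 1)) → X b = X' b') :
    (∑ x : Res (bigRoot Lc rs (n + 1)) (bigRatio Lc (n + 1)) (towerTorus Lc M (n + 1)),
        (if (x.1 : ↥(pbox (towerTorus Lc M (n + 1)))) = s then (E *ᵥ θ) (towerEquiv Lc M rs hrs (n + 1) x) else 0))
      = ∑ x' : Res (bigRoot Lc rs (n + 1)) (bigRatio Lc (n + 1)) (towerTorus Lc M' (n + 1)),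
        (if (x'.1 : ↥(pbox (towerTorus Lc M' (n + 1)))) = s' then (E' *ᵥ θ') (towerEquiv Lc M' rs hrs (n + 1) x') else 0) :=
  treeGauge_readout_corr Lc (QSym Lc) (QSym_twoBlock Lc) (QSym_blockTranslate Lc) M M' lev rs hrs hM hM' n v hQ₁₀ hτ₁ hτ₂ hN hW₀ hE hQ₁₀' hτ₁' hτ₂' hN' hW₀' hE'
    hTW hTW' hθ hθ' s s' hs hX

/-- **THE READ-OUT APPLIED TO CORRESPONDING COLUMNS, AT THE RECORD**: `((E·(N·W₀)⁻¹·N) *ᵥ X) p = ((E′·(N′·W₀′)⁻¹·N′) *ᵥ X′) p′` for corresponding slots `p ↔ p′` and columns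
agreeing on the corresponding bonds inside `p`'s big block. -/
theorem readout_mulVec_corr_sym
    {Q₁₀ : Matrix (↥(pbox M) × Fin (d + 1)) (↥(pbox (towerTorus Lc M (n + 1))) × Fin (d + 1)) ℝ} (hQ₁₀ : Q₁₀ = compRowsSym Lc M lev rs (n + 1))
    {τ₁ : Matrix (NParam Lc (fine Lc M) (fun k => rs (k + 1)) n) (↥(pbox (towerTorus Lc M (n + 1))) × Fin (d + 1)) ℝ}
    (hτ₁ : τ₁ = bigP Lc (fine Lc M) (fun k => rs (k + 1)) (fun k => hrs (k + 1)) n)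
    {τ₂ : Matrix (Res (toSite (rs 0)) Lc M) (↥(pbox M) × Fin (d + 1)) ℝ} (hτ₂ : τ₂ = combF Lc M (rs 0))
    {N : Matrix (NParam Lc M rs (n + 1)) (↥(pbox (towerTorus Lc M (n + 1))) × Fin (d + 1)) ℝ} (hN : N = Matrix.fromRows (τ₂ * Q₁₀) τ₁)
    {W₀ : Matrix (↥(pbox (towerTorus Lc M (n + 1))) × Fin (d + 1)) (NParam Lc M rs (n + 1)) ℝ} (hW₀ : W₀ = towerGen Lc M rs (n + 1))
    {E : Matrix (NParam Lc M rs (n + 1)) (NParam Lc M rs (n + 1)) ℝ} (hE : E = towerEvalC Lc M rs hrs (n + 1))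
    {Q₁₀' : Matrix (↥(pbox M') × Fin (d + 1)) (↥(pbox (towerTorus Lc M' (n + 1))) × Fin (d + 1)) ℝ} (hQ₁₀' : Q₁₀' = compRowsSym Lc M' lev rs (n + 1))
    {τ₁' : Matrix (NParam Lc (fine Lc M') (fun k => rs (k + 1)) n) (↥(pbox (towerTorus Lc M' (n + 1))) × Fin (d + 1)) ℝ}
    (hτ₁' : τ₁' = bigP Lc (fine Lc M') (fun k => rs (k + 1)) (fun k => hrs (k + 1)) n)
    {τ₂' : Matrix (Res (toSite (rs 0)) Lc M') (↥(pbox M') × Fin (d + 1)) ℝ} (hτ₂' : τ₂' = combF Lc M' (rs 0))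
    {N' : Matrix (NParam Lc M' rs (n + 1)) (↥(pbox (towerTorus Lc M' (n + 1))) × Fin (d + 1)) ℝ} (hN' : N' = Matrix.fromRows (τ₂' * Q₁₀') τ₁')
    {W₀' : Matrix (↥(pbox (towerTorus Lc M' (n + 1))) × Fin (d + 1)) (NParam Lc M' rs (n + 1)) ℝ} (hW₀' : W₀' = towerGen Lc M' rs (n + 1))
    {E' : Matrix (NParam Lc M' rs (n + 1)) (NParam Lc M' rs (n + 1)) ℝ} (hE' : E' = towerEvalC Lc M' rs hrs (n + 1))
    (hTW : (N * W₀).det ≠ 0) (hTW' : (N' * W₀').det ≠ 0)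
    (p : NParam Lc M rs (n + 1)) (p' : NParam Lc M' rs (n + 1))
    (hp : ((towerEquiv Lc M' rs hrs (n + 1)).symm p').site = ((towerEquiv Lc M rs hrs (n + 1)).symm p).site + ((bigRatio Lc (n + 1) : ℕ) : ℤ) • v)
    (X : ↥(pbox (towerTorus Lc M (n + 1))) × Fin (d + 1) → ℝ) (X' : ↥(pbox (towerTorus Lc M' (n + 1))) × Fin (d + 1) → ℝ)
    (hX : ∀ (b : ↥(pbox (towerTorus Lc M (n + 1))) × Fin (d + 1)) (b' : ↥(pbox (towerTorus Lc M' (n + 1))) × Fin (d + 1)),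
      (b'.1 : Site (d + 1)) = (b.1 : Site (d + 1)) + ((bigRatio Lc (n + 1) : ℕ) : ℤ) • v → b'.2 = b.2 →
      quo (bigRatio Lc (n + 1)) (b.1 : Site (d + 1)) = quo (bigRatio Lc (n + 1)) ((towerEquiv Lc M rs hrs (n + 1)).symm p).site →
      quo (bigRatio Lc (n + 1)) ((b.1 : Site (d + 1)) + unitVec b.2) = quo (bigRatio Lc (n + 1)) ((towerEquiv Lc M rs hrs (n + 1)).symm p).site → X b = X' b') :
    ((E * (N * W₀)⁻¹ * N) *ᵥ X) p = ((E' * (N' * W₀')⁻¹ * N') *ᵥ X') p' :=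
  readout_mulVec_corr Lc (QSym Lc) (QSym_twoBlock Lc) (QSym_blockTranslate Lc) M M' lev rs hrs hM hM' n v hQ₁₀ hτ₁ hτ₂ hN hW₀ hE hQ₁₀' hτ₁' hτ₂' hN' hW₀' hE'
    hTW hTW' p p' hp X X' hX

end Record

end Summit.QuantumFields.BalabanUV.Beta.FP.QstepSymBlockTranslate

end
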